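import Summits.HubbardSuperconductivity.HubbardLadder.Bounds.ThermalMottPairCeiling
import Literature.MathematicalPhysics.QuantumLattice.HubbardKuboKishiGaussianDomination
import HarnessLib

/-!
# Hubbard ladder — Bounds: the thermal Mott-window CDW and `s`-wave pair ceilings of the half-filled
# repulsive torus, UNCONDITIONAL (bounds.tex Cor. 11.1(ii) with the Kubo–Kishi hypothesis discharged)

HONEST FRAMING (cell pub-hubbard): ladder R1–R4 with certified numbers; no claim on H/H₀. These
are bounds for a MODEL CLASS — the repulsive Hubbard torus `hamiltonianWith (fermionTorusGraph 2 L)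
1 U (U/2)` (`t = 1`, `U > 0`, `μ = U/2`, torus `(ℤ/Lℤ)²`, `L ≥ 4` even) in its grand-canonical Gibbs
state at `β > 0`; no materials claim. Companion text: `pub-hubbard/paper/bounds.tex` Cor. 11.1(ii);
tables `pub-hubbard/pub-hubbard-bounds/BOUNDS.md` (row T9♯) and `EXTREMISERS.md` §§5o, 5q.

`ThermalMottCDWCeiling.lean` (LEAN FILING REQUEST #163) and `ThermalMottPairCeiling.lean` (#165) prove
the CDW half and the pair half of Cor. 11.1(ii) as the nodes `ThermalMottCDWCeilingKK`,
`ThermalMottCDWCeilingU20KK`, `ThermalMottSWavePairCeilingKK`, `ThermalMottSWavePairCeilingU20KK`, each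
stated with the published Kubo–Kishi Gaussian domination (KK90 Thm 2) as an explicit hypothesis
`kuboKishi_charge_gaussianDomination` (a named Literature fact — never an axiom). That fact is now a
THEOREM of the tree: `kuboKishi_charge_gaussianDomination_holds`
(`Literature/MathematicalPhysics/QuantumLattice/HubbardKuboKishiGaussianDomination.lean`: Kubo–Kishi's
own proof — the Dyson–Lieb–Simon trace inequality for the attractive model, transported to the
repulsive half-filled model by Shiba's transformation `c_{x↓} ↦ ε_x c†_{x↓}`). This file records the
four ceilings with the hypothesis DISCHARGED, as the nodes `ThermalMottCDWCeiling`,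
`ThermalMottCDWCeilingU20`, `ThermalMottSWavePairCeiling`, `ThermalMottSWavePairCeilingU20` (one-line
proofs: the conditional node fed the theorem).

## What is proved (no `sorry`, no new axioms; every statement UNCONDITIONAL)

On the half-filled torus (`Even L`, `3 ≤ L`), for `0 ≤ U₁ < U`, `Δ ≠ 0`, `β > 0`, with
`κ_max := L² (U₁ sdwClosed U Δ - U lmClosed U₁)/(U - U₁) + (U₁/(U - U₁)) L² log 4/β` the right side of
Cor. 11.1(i):
* `ThermalMottCDWCeiling`: `Re⟨F_Q²⟩_β ≤ L²/(βU) + ½ √((L²/U)·4 κ_max)`, `F_Q = Σ_x (-1)^x (n_x - 1)`;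
* `ThermalMottSWavePairCeiling`: `Re⟨B†B⟩_β ≤ ½ [L²/(βU) + ½ √((L²/U)·4 κ_max)]`, `B = Σ_x c_{x↓}c_{x↑}`;
* the instances at `U = 20` (`U₁ = Δ = 10`): per site `S_cdw(π,π)/L² ≤ T/20 + √((1.228 + T log 4)/20)`
  (`= 0.248` at `T → 0`) and `P_s ≤ T/40 + ½ √((1.228 + T log 4)/20)` (`= 0.124` at `T → 0`).

Honest numbers: `O(1)` per-site ceilings (no CDW / on-site-pair long-range order at any `T > 0` in the
Mott window, with explicit interaction-dependent constants); informative only for `U ≳ 14 t`, `T ≲ t`;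
`μ = U/2` and bipartite hopping only; nothing here bears on d-wave pairing or on the doped model.
References (keys of `lean/references.bib`): KuboKishi1990 Thms 1–2, Remark 3; Shiba1972 §2;
DysonLiebSimon1978 Thm 3.1 / Lemma 4.1; Zhang1990; YangZhang1990 Thm 1; LiebLossMccann1993 eq. (5);
Shastry1997 eq. (1); LangerMattis1971 eqs. (3)–(5).
-/

noncomputable section

namespace Summit.HubbardSuperconductivity.HubbardLadder.Bounds

open Matrix Finset Real
open Literature.MathematicalPhysics.QuantumLattice
open Literature.Probability.LatticeModels
open scoped ComplexOrder ComplexConjugate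

section Torus

/-- **Cor. 11.1(ii), CDW half, UNCONDITIONAL.** The thermal Mott-window ceiling on the `(π,π)`
charge structure factor of the half-filled repulsive Hubbard torus at every `β > 0`:
`Re⟨F_Q²⟩_β ≤ L²/(βU) + ½ √((L²/U) · 4 κ_max)`. -/
@[conjecture] def ThermalMottCDWCeiling : Prop :=
  ∀ (L : ℕ) [NeZero L], Even L → 3 ≤ L → ∀ (U U₁ Δ β : ℝ), 0 ≤ U₁ → U₁ < U → Δ ≠ 0 → 0 < β →
    (gibbsState β (hamiltonianWith (fermionTorusGraph 2 L) 1 U (U / 2))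
        (chargeDensityField (fun x => ((torusStagger (d := 2) (L := L) x : ℤ) : ℝ)) *
          chargeDensityField fun x => ((torusStagger (d := 2) (L := L) x : ℤ) : ℝ))).re ≤
      (L : ℝ) ^ 2 / U / β +
        1 / 2 * Real.sqrt ((L : ℝ) ^ 2 / U *
          (4 * ((L : ℝ) ^ 2 * ((U₁ * sdwClosed U Δ - U * lmClosed U₁) / (U - U₁)) +
            U₁ / (U - U₁) * ((L : ℝ) ^ 2 * Real.log 4 / β))))

/-- **`ThermalMottCDWCeiling` holds** (the conditional node fed Kubo–Kishi's theorem). -/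
theorem thermalMottCDWCeiling_holds : ThermalMottCDWCeiling :=
  thermalMottCDWCeilingKK_holds kuboKishi_charge_gaussianDomination_holds

/-- **Cor. 11.1(ii), CDW half at `U = 20`, UNCONDITIONAL**: per site
`S_cdw(π,π)/L² ≤ T/20 + √((1.228 + T log 4)/20)` at every `T > 0`. -/
@[conjecture] def ThermalMottCDWCeilingU20 : Prop :=
  ∀ (L : ℕ) [NeZero L], Even L → 3 ≤ L → ∀ β : ℝ, 0 < β →
    (gibbsState β (hamiltonianWith (fermionTorusGraph 2 L) 1 20 (20 / 2))
        (chargeDensityField (fun x => ((torusStagger (d := 2) (L := L) x : ℤ) : ℝ)) *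
          chargeDensityField fun x => ((torusStagger (d := 2) (L := L) x : ℤ) : ℝ))).re ≤
      (L : ℝ) ^ 2 * (1 / (20 * β) + Real.sqrt ((1.228 + Real.log 4 / β) / 20))

/-- **`ThermalMottCDWCeilingU20` holds.** -/
theorem thermalMottCDWCeilingU20_holds : ThermalMottCDWCeilingU20 :=
  thermalMottCDWCeilingU20KK_holds kuboKishi_charge_gaussianDomination_holds

/-- **Cor. 11.1(ii), pair half, UNCONDITIONAL.** The thermal Mott-window ceiling on the uniform
on-site pair structure factor `⟨B†B⟩_β`, `B = Σ_x c_{x↓}c_{x↑}` (`= η_1`), of the half-filled repulsive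
Hubbard torus at every `β > 0`: `Re⟨B†B⟩_β ≤ ½ [L²/(βU) + ½ √((L²/U) · 4 κ_max)]`. -/
@[conjecture] def ThermalMottSWavePairCeiling : Prop :=
  ∀ (L : ℕ) [NeZero L], Even L → 3 ≤ L → ∀ (U U₁ Δ β : ℝ), 0 ≤ U₁ → U₁ < U → Δ ≠ 0 → 0 < β →
    (gibbsState β (hamiltonianWith (fermionTorusGraph 2 L) 1 U (U / 2))
        ((uniformOnSitePair 2 L)ᴴ * uniformOnSitePair 2 L)).re ≤
      1 / 2 * ((L : ℝ) ^ 2 / U / β +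
        1 / 2 * Real.sqrt ((L : ℝ) ^ 2 / U *
          (4 * ((L : ℝ) ^ 2 * ((U₁ * sdwClosed U Δ - U * lmClosed U₁) / (U - U₁)) +
            U₁ / (U - U₁) * ((L : ℝ) ^ 2 * Real.log 4 / β)))))

/-- **`ThermalMottSWavePairCeiling` holds.** -/
theorem thermalMottSWavePairCeiling_holds : ThermalMottSWavePairCeiling :=
  thermalMottSWavePairCeilingKK_holds kuboKishi_charge_gaussianDomination_holds

/-- **Cor. 11.1(ii), pair half at `U = 20`, UNCONDITIONAL**: per site
`P_s ≤ T/40 + ½ √((1.228 + T log 4)/20)` at every `T > 0` (`= 0.124` at `T → 0`). -/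
@[conjecture] def ThermalMottSWavePairCeilingU20 : Prop :=
  ∀ (L : ℕ) [NeZero L], Even L → 3 ≤ L → ∀ β : ℝ, 0 < β →
    (gibbsState β (hamiltonianWith (fermionTorusGraph 2 L) 1 20 (20 / 2))
        ((uniformOnSitePair 2 L)ᴴ * uniformOnSitePair 2 L)).re ≤
      (L : ℝ) ^ 2 * (1 / (40 * β) + 1 / 2 * Real.sqrt ((1.228 + Real.log 4 / β) / 20))

/-- **`ThermalMottSWavePairCeilingU20` holds.** -/
theorem thermalMottSWavePairCeilingU20_holds : ThermalMottSWavePairCeilingU20 :=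
  thermalMottSWavePairCeilingU20KK_holds kuboKishi_charge_gaussianDomination_holds

end Torus

end Summit.HubbardSuperconductivity.HubbardLadder.Bounds
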